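import Summits.NavierStokesRegularity.NavierStokesRegularity.Theses.HardyPointSink
import Literature.Probability.Distributions.GaussianSphereMarginal
import Mathlib.Analysis.SpecialFunctions.Integrals.Basic
import HarnessLib

/-!
# Route HardyPointSink — `HardyEnergyBound` (C2): the tail test

Helper file for the crux item stmt-NavierStokesRegularity-7979 (line `birth`, lead c2). The route's
kill criterion (i) — "a `C/|x − x*|` tail down to the parabolic scale makes the Hardy energy diverge
like `4πC² log(1/(T−t))`" — as a lemma of real analysis, usable by the disprover and by the next line:

* `hardyEnergyBound_tail_lower_bound` — if `C/|x − x_c| ≤ |w(x)|` on the shell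
  `ρ ≤ |x − x_c| < δ` (`0 < ρ < δ`, `0 ≤ C`), then
  `∫⁻_{B(x_c, δ)} |w|²/|x − x_c| ≥ 3|B₁| · C² · log(δ/ρ)` (`3|B₁| = 4π`).

So the local Hardy bound of C2 at a blow-up point `x*` fails for every Kato solution whose slices keep
a `C/|x − x*|` lower envelope on shells `ρ(t) ≤ |x − x*| < δ` with `ρ(t) → 0` (any tailed Type-I or
Type-II scenario), and C2 has content exactly on the borderline `|u| = o(1/|x − x*|)` "in `L²(dx/|x|)`
average" — the tail-free profiles (lead analysis HEART.md §3).
-/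

noncomputable section

open MeasureTheory Set Filter Topology Metric Function Module
open scoped ENNReal NNReal

set_option linter.dupNamespace false -- nested layout Summit.<S>.<Sub>, Sub = S (D-0017)

namespace Summit.NavierStokesRegularity.NavierStokesRegularity.Theorems

/-- The radial weight `1_{[ρ, δ)}(r) · C²/r³` integrated against `r²` over `(0, ∞)` is
`C² log(δ/ρ)` (`0 < ρ < δ`). -/
theorem hardyEnergyBound_tail_radial_integral {C ρ δ : ℝ} (hρ : 0 < ρ) (hρδ : ρ < δ) :
    ∫⁻ y in Ioi (0 : ℝ), ENNReal.ofReal (y ^ 2) *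
        (Ico ρ δ).indicator (fun r => ENNReal.ofReal (C ^ 2 / r ^ 3)) y =
      ENNReal.ofReal (C ^ 2 * Real.log (δ / ρ)) := by
  have hδ : 0 < δ := hρ.trans hρδ
  -- move the indicator outside and restrict to the shell radii
  have h1 : (fun y : ℝ => ENNReal.ofReal (y ^ 2) *
      (Ico ρ δ).indicator (fun r => ENNReal.ofReal (C ^ 2 / r ^ 3)) y) =
      (Ico ρ δ).indicator (fun y => ENNReal.ofReal (y ^ 2) * ENNReal.ofReal (C ^ 2 / y ^ 3)) := by
    funext y
    by_cases hy : y ∈ Ico ρ δ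
    · rw [indicator_of_mem hy, indicator_of_mem hy]
    · rw [indicator_of_notMem hy, indicator_of_notMem hy, mul_zero]
  have hsub : Ico ρ δ ⊆ Ioi (0 : ℝ) := fun y hy => hρ.trans_le hy.1
  rw [h1, lintegral_indicator measurableSet_Ico, Measure.restrict_restrict measurableSet_Ico,
    inter_eq_self_of_subset_left hsub]
  -- on the shell radii the integrand is `C²/y`
  have h2 : ∫⁻ y in Ico ρ δ, ENNReal.ofReal (y ^ 2) * ENNReal.ofReal (C ^ 2 / y ^ 3) =
      ∫⁻ y in Ico ρ δ, ENNReal.ofReal (C ^ 2 / y) := by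
    refine setLIntegral_congr_fun measurableSet_Ico fun y hy => ?_
    have hy0 : 0 < y := hρ.trans_le hy.1
    rw [← ENNReal.ofReal_mul (sq_nonneg y)]
    congr 1
    field_simp
  rw [h2]
  -- Bochner form and the logarithm
  have hcont : ContinuousOn (fun y : ℝ => C ^ 2 / y) (Icc ρ δ) :=
    continuousOn_const.div continuousOn_id fun y hy => (hρ.trans_le hy.1).ne'
  have hint : IntegrableOn (fun y : ℝ => C ^ 2 / y) (Ico ρ δ) :=
    (hcont.integrableOn_Icc).mono_set Ico_subset_Icc_self
  have hnn : 0 ≤ᵐ[volume.restrict (Ico ρ δ)] fun y : ℝ => C ^ 2 / y := by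
    rw [EventuallyLE, ae_restrict_iff' measurableSet_Ico]
    exact Eventually.of_forall fun y hy => div_nonneg (sq_nonneg C) (hρ.trans_le hy.1).le
  rw [← ofReal_integral_eq_lintegral_ofReal hint hnn, integral_Ico_eq_integral_Ioc,
    ← intervalIntegral.integral_of_le hρδ.le]
  congr 1
  have h3 : ∫ y in ρ..δ, C ^ 2 / y = C ^ 2 * ∫ y in ρ..δ, y⁻¹ := by
    rw [← intervalIntegral.integral_const_mul]
    refine intervalIntegral.integral_congr fun y _ => ?_
    simp [div_eq_mul_inv]
  rw [h3, integral_inv_of_pos hρ hδ]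

/-- **TAIL TEST for the Hardy energy.** If a field `w` has the lower envelope `C/|x − x_c| ≤ |w(x)|`
on the shell `ρ ≤ |x − x_c| < δ` (`0 < ρ < δ`, `0 ≤ C`), then its local Hardy energy at the sink
`x_c` obeys `∫⁻_{B(x_c, δ)} |w|²/|x − x_c| ≥ 3|B₁| C² log(δ/ρ) = 4πC² log(δ/ρ)`. Proof: on the shell
`|w|²/r ≥ C²/r³`; the shell lies in the ball; translate to `x_c = 0`, integrate in polar
coordinates (`lintegral_fun_norm_addHaar`, `d = 3`) and use `∫_ρ^δ dr/r = log(δ/ρ)`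
(`hardyEnergyBound_tail_radial_integral`). This is the route's kill criterion (i) as a lemma: a
`C/|x − x*|` tail persisting down to scales `ρ(t) → 0` forces the Hardy energy of C2 to diverge
logarithmically. -/
theorem hardyEnergyBound_tail_lower_bound :
    ∀ (w : EuclideanSpace ℝ (Fin 3) → EuclideanSpace ℝ (Fin 3)) (xc : EuclideanSpace ℝ (Fin 3))
      (C ρ δ : ℝ), 0 ≤ C → 0 < ρ → ρ < δ →
      (∀ x, ρ ≤ ‖x - xc‖ → ‖x - xc‖ < δ → C / ‖x - xc‖ ≤ ‖w x‖) →
      ENNReal.ofReal (3 * (MeasureTheory.volume : MeasureTheory.Measure (EuclideanSpace ℝ (Fin 3))).real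
          (Metric.ball 0 1) * (C ^ 2 * Real.log (δ / ρ))) ≤
        ∫⁻ x in Metric.ball xc δ, ‖w x‖ₑ ^ 2 / ‖x - xc‖ₑ := by
  intro w xc C ρ δ hC hρ hρδ htail
  -- the radial minorant
  set G : ℝ → ℝ≥0∞ := (Ico ρ δ).indicator fun r => ENNReal.ofReal (C ^ 2 / r ^ 3) with hG
  have hGm : Measurable G :=
    (ENNReal.measurable_ofReal.comp (measurable_const.div (measurable_id.pow_const 3))).indicator
      measurableSet_Ico
  -- pointwise: `G |x - xc| ≤ |w x|² / |x - xc|`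
  have hpt : ∀ x, G ‖x - xc‖ ≤ ‖w x‖ₑ ^ 2 / ‖x - xc‖ₑ := by
    intro x
    by_cases hx : ‖x - xc‖ ∈ Ico ρ δ
    · have hr : 0 < ‖x - xc‖ := hρ.trans_le hx.1
      rw [hG, indicator_of_mem hx]
      have h1 : ENNReal.ofReal ((C / ‖x - xc‖) ^ 2) ≤ ‖w x‖ₑ ^ 2 := by
        rw [← ofReal_norm, ← ENNReal.ofReal_pow (norm_nonneg _)]
        exact ENNReal.ofReal_le_ofReal
          (pow_le_pow_left₀ (div_nonneg hC hr.le) (htail x hx.1 hx.2) 2)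
      calc ENNReal.ofReal (C ^ 2 / ‖x - xc‖ ^ 3)
          = ENNReal.ofReal ((C / ‖x - xc‖) ^ 2 / ‖x - xc‖) := by
            congr 1
            field_simp
        _ = ENNReal.ofReal ((C / ‖x - xc‖) ^ 2) / ‖x - xc‖ₑ := by
            rw [ENNReal.ofReal_div_of_pos hr, ofReal_norm]
        _ ≤ ‖w x‖ₑ ^ 2 / ‖x - xc‖ₑ := ENNReal.div_le_div_right h1 _
    · rw [hG, indicator_of_notMem hx]
      exact zero_le
  -- the minorant vanishes off the ball
  have hsupp : (support fun x => G ‖x - xc‖) ⊆ ball xc δ := by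
    intro x hx
    rw [mem_support] at hx
    have hmem : ‖x - xc‖ ∈ Ico ρ δ := by
      by_contra h
      exact hx (by rw [hG, indicator_of_notMem h])
    rw [mem_ball, dist_eq_norm]
    exact hmem.2
  -- polar coordinates
  have hpolar : ∫⁻ x, G ‖x‖ ∂(volume : Measure (EuclideanSpace ℝ (Fin 3))) =
      3 * volume (ball (0 : EuclideanSpace ℝ (Fin 3)) 1) * ENNReal.ofReal (C ^ 2 * Real.log (δ / ρ)) := by
    rw [Literature.Probability.Distributions.lintegral_fun_norm_addHaar volume G hGm,
      finrank_euclideanSpace_fin]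
    norm_num
    rw [hG, hardyEnergyBound_tail_radial_integral hρ hρδ]
  calc ENNReal.ofReal (3 * (volume : Measure (EuclideanSpace ℝ (Fin 3))).real (ball 0 1) *
          (C ^ 2 * Real.log (δ / ρ)))
      = 3 * volume (ball (0 : EuclideanSpace ℝ (Fin 3)) 1) * ENNReal.ofReal (C ^ 2 * Real.log (δ / ρ)) := by
        rw [ENNReal.ofReal_mul (by positivity), ENNReal.ofReal_mul (by norm_num), Measure.real,
          ENNReal.ofReal_toReal measure_ball_lt_top.ne, ENNReal.ofReal_ofNat]
    _ = ∫⁻ x, G ‖x‖ ∂(volume : Measure (EuclideanSpace ℝ (Fin 3))) := hpolar.symm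
    _ = ∫⁻ x, G ‖x - xc‖ ∂(volume : Measure (EuclideanSpace ℝ (Fin 3))) :=
        (lintegral_sub_right_eq_self (fun x => G ‖x‖) xc).symm
    _ = ∫⁻ x in ball xc δ, G ‖x - xc‖ := (setLIntegral_eq_of_support_subset hsupp).symm
    _ ≤ ∫⁻ x in ball xc δ, ‖w x‖ₑ ^ 2 / ‖x - xc‖ₑ := lintegral_mono fun x => hpt x

end Summit.NavierStokesRegularity.NavierStokesRegularity.Theorems

end
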